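import Summits.BirchSwinnertonDyer.Rank1Residual.X11b.BDPRouteRelaxation
import HarnessLib

/-!
# Cassels' theorem from Poitou–Tate, local input: the local term `inv_v(t_v ∪ₑ c_v)` vanishes when `c_v`
# comes from a LOWER Kummer level — single-level form (crux K4, line `eulerchar`, Cassels lane)

Crux K4 `SignedControlAtTwo` (stmt-BirchSwinnertonDyer-20309; routes `ThetaPartnerAtTwo` /
`ResidualThetaTransportAtTwo`), line `eulerchar` v10, stub `stub_pubGreenbergPTTwo` = {Cassels, Prop. 4.12,
`poitouTate_selmerStructure_duality ℚ`}; width seat `prover-bsd-wall-tp2-p3-w3` g6. This file is the LOCAL half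
of the reduction «Cassels ⟸ Poitou–Tate» (`Cruxes/SignedControlAtTwo/CASSELS-VIA-PT-PLAN.md`), in a form that
needs NO Weil-pairing level compatibility and NO cross-level cup product: everything happens at ONE level `N`.

Greenberg, LNM 1716, p. 121 («if `S_{M*}(F)` is finite and `M*(F) = 0` then `coker(γ) = 0`»): in the
Poitou–Tate obstruction `∑_v inv_v(t_v ∪ₑ c_v)` against a test class `c`, the local class `c_v` lies in the
Kummer condition `𝓛_v^{(N)}` AND `c = ι_* z` comes from level `d ∣ N`, `N = d·m`. Then (this file):

* `map_torsionPointsMapIntertwining_map_torsionInclusion` — `κ^{(N)} ∘ ι_* = κ^{(d)}` on `H¹(Γ_E, E[d])`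
  (change of coefficients to `E(K̄_E)` composes);
* `localKummerClass_nsmul` — `κ_N(m • R) = m • κ_N(R)` for the local Kummer classes of `KummerSelmerStructure`;
* **`exists_eq_nsmul_localKummerClass_of_map_torsionInclusion_mem`** — if `ι_* z_v ∈ 𝓛^{(N)}` then
  `ι_* z_v = m • κ_N(R)` for a local point `R` with `N • R ∈ E(E)` (so `κ_N(R) ∈ 𝓛^{(N)}`): `z_v ∈ 𝓛^{(d)}`
  (by the first item), `z_v = κ_d(Q)`, `ι_* κ_d(Q) = κ_N(Q)` (tree `map_torsionInclusion_localKummerClass`),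
  `Q = m • R` (divisibility of `E(K̄_E)`);
* **`invWeilPairing_nsmul_eq_zero_of_nsmul_mem`** — `inv_v(t ∪ₑ (m • l)) = 0` whenever `m • t ∈ 𝓛_v` and
  `l ∈ 𝓛_v` (bilinearity + the Poonen–Rains isotropy `invWeilPairing_eq_zero_of_mem`, EVERY place, EVERY `inv`);

THEOREMS ONLY (no definition, no named fact, no `sorry`); pure local algebra over any `K`-field `E`; BSD is not
proved by any of this.

References: [GreenbergLNM1716] §4, Prop. 4.13 and p. 121–122; [MilneADT2006] I §6, proof of Prop. 6.9
(«`b_{v,1}` in the image of `A(K_v)`»), Lemma 6.15; [PoonenRains2012] Prop. 4.10.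
-/

set_option autoImplicit false
-- the Theorems namespace of this sub repeats the summit name by design (D-0017 nested layout)
set_option linter.dupNamespace false

noncomputable section

open scoped Classical

universe u

open Field Function NumberField IsDedekindDomain WeierstrassCurve
open Literature.NumberTheory.EllipticCurves Literature.NumberTheory.GaloisRepresentations
open Literature.NumberTheory.GaloisCohomology
open scoped ContRepresentation

namespace Summit.BirchSwinnertonDyer.BirchSwinnertonDyer.Theorems.SignedEC.CasselsPT

/-! ## §1 Change of coefficients composes: `κ^{(N)} ∘ ι_* = κ^{(d)}` -/

section Coefficients

variable {K : Type u} [Field K] (W : WeierstrassCurve K) (E : Type u) [Field E] [Algebra K E]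

/-- **`κ^{(N)} ∘ ι_* = κ^{(d)}`**: for `d ∣ N`, mapping a class of `H¹(Γ_E, E[d])` to `H¹(Γ_E, E[N])` along
`E[d] ↪ E[N]` and then to `H¹(Γ_E, E(K̄_E))` is mapping it to `H¹(Γ_E, E(K̄_E))` directly (the composite
`E[d] ↪ E[N] ↪ E(K̄) → E(K̄_E)` is `E[d] ↪ E(K̄) → E(K̄_E)`; same cocycle). [folklore] -/
theorem map_torsionPointsMapIntertwining_map_torsionInclusion {d N : ℤ} (h : d ∣ N)
    (z : galoisCohomology (GaloisRep.restrictField E (W.torsionGaloisModule d)) 1) :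
    galoisCohomology.map (W.torsionPointsMapIntertwining N E) 1
        (galoisCohomology.map ((W.torsionInclusion h).restrictField E) 1 z) =
      galoisCohomology.map (W.torsionPointsMapIntertwining d E) 1 z := by
  obtain ⟨φ, rfl⟩ := oneCocycleClass_surjective _ z
  rw [galoisCohomology.map_one_oneCocycleClass, galoisCohomology.map_one_oneCocycleClass,
    galoisCohomology.map_one_oneCocycleClass]
  rfl

/-- If `ι_* z` satisfies the level-`N` local Kummer condition then `z` satisfies the level-`d` one
(`𝓛 = ker κ`, and `κ^{(N)} ∘ ι_* = κ^{(d)}`). [folklore] -/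
theorem mem_kummerLocalConditionAt_of_map_torsionInclusion_mem {d N : ℤ} (h : d ∣ N)
    {z : galoisCohomology (GaloisRep.restrictField E (W.torsionGaloisModule d)) 1}
    (hz : galoisCohomology.map ((W.torsionInclusion h).restrictField E) 1 z ∈ W.kummerLocalConditionAt N E) :
    z ∈ W.kummerLocalConditionAt d E := by
  rw [WeierstrassCurve.mem_kummerLocalConditionAt_iff] at hz ⊢
  rw [← map_torsionPointsMapIntertwining_map_torsionInclusion W E h z]
  exact hz

end Coefficients

/-! ## §2 Local Kummer classes of multiples: `κ_N(m • R) = m • κ_N(R)` -/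

section KummerMultiples

variable {K : Type u} [Field K] [CharZero K] (W : WeierstrassCurve K) [W.IsElliptic]
  {E : Type u} [Field E] [Algebra K E] (n : ℤ) (hn : n ≠ 0)

omit [CharZero K] [W.IsElliptic] in
/-- A `Γ_E`-fixed multiple `n • R` gives a `Γ_E`-fixed multiple `n • (m • R)`. [folklore] -/
theorem zsmul_zsmul_mem_fixedPoints_localPoints (m : ℤ) {R : localPoints W E}
    (hR : n • R ∈ MulAction.fixedPoints (absoluteGaloisGroup E) (localPoints W E)) :
    n • (m • R) ∈ MulAction.fixedPoints (absoluteGaloisGroup E) (localPoints W E) := by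
  intro σ
  rw [smul_comm n m R, W.smul_zsmul_localPoints m σ (n • R), hR σ]

/-- `κ_N(0) = 0` for the local Kummer class (`0` is `Γ_E`-fixed up to the torsion point `0`). [folklore] -/
theorem localKummerClass_zero
    (h0 : n • (0 : localPoints W E) ∈ MulAction.fixedPoints (absoluteGaloisGroup E) (localPoints W E)) :
    W.localKummerClass n hn (0 : localPoints W E) h0 = 0 := by
  rw [W.localKummerClass_eq_zero_iff n hn]
  refine ⟨0, zero_mem _, fun σ ↦ ?_⟩
  rw [sub_zero]
  exact smul_zero σ

/-- **`κ_N(m • R) = m • κ_N(R)`** for the local Kummer classes of `KummerSelmerStructure.lean` (induction on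
`m` with the tree's `localKummerClass_add`: `δ` is a homomorphism). Silverman, *AEC*, VIII.§2. [folklore] -/
theorem localKummerClass_nsmul (m : ℕ) (R : localPoints W E)
    (hR : n • R ∈ MulAction.fixedPoints (absoluteGaloisGroup E) (localPoints W E))
    (hmR : n • (m • R) ∈ MulAction.fixedPoints (absoluteGaloisGroup E) (localPoints W E)) :
    W.localKummerClass n hn (m • R) hmR = m • W.localKummerClass n hn R hR := by
  induction m with
  | zero =>
    have h0 : n • (0 : localPoints W E) ∈ MulAction.fixedPoints (absoluteGaloisGroup E) (localPoints W E) := by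
      rw [← zero_nsmul R]; exact hmR
    rw [localKummerClass_congr (zero_nsmul R) (hQ' := h0), localKummerClass_zero W n hn h0, zero_nsmul]
  | succ m ih =>
    have hmR' : n • (m • R) ∈ MulAction.fixedPoints (absoluteGaloisGroup E) (localPoints W E) := by
      rw [← natCast_zsmul]; exact zsmul_zsmul_mem_fixedPoints_localPoints W n (m : ℤ) hR
    have hsum : n • (m • R + R) ∈ MulAction.fixedPoints (absoluteGaloisGroup E) (localPoints W E) := by
      rw [← succ_nsmul]; exact hmR
    rw [localKummerClass_congr (succ_nsmul R m) (hQ' := hsum),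
      W.localKummerClass_add n hn (m • R) R hmR' hR hsum, ih hmR', succ_nsmul]

/-- **A level-`d` local Kummer class pushed to level `N = d·m` is an `m`-th MULTIPLE of a level-`N` local
Kummer class**: for `z ∈ H¹(Γ_E, E[d])` with `ι_* z ∈ 𝓛_E^{(N)}` there is a local point `R` with `N • R ∈ E(E)`
and `ι_* z = m • κ_N(R)`. Proof: `z ∈ 𝓛^{(d)}` (`mem_kummerLocalConditionAt_of_map_torsionInclusion_mem`), so
`z = κ_d(Q)` with `d • Q ∈ E(E)`; `ι_* κ_d(Q) = κ_N(Q)` (tree `map_torsionInclusion_localKummerClass`); write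
`Q = m • R` (divisibility of `E(K̄_E)`); then `N • R = d • Q ∈ E(E)` and `κ_N(Q) = m • κ_N(R)`. This is the
local half of Greenberg's remark «if `S_{M*}(F)` is finite and `M*(F) = 0` then `coker(γ) = 0`» (p. 121)
and of Milne's «`b_{v,1}` in the image of `A(K_v)`» (I §6, proof of Prop. 6.9).
[cite: GreenbergLNM1716, §4 Appendix p. 121] [cite: MilneADT2006, Ch. I §6, proof of Prop. 6.9] -/
theorem exists_eq_nsmul_localKummerClass_of_map_torsionInclusion_mem {d N : ℤ} (m : ℕ)
    (hdm : d * m = N) (hd : d ≠ 0) (hN : N ≠ 0)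
    {z : galoisCohomology (GaloisRep.restrictField E (W.torsionGaloisModule d)) 1}
    (hz : galoisCohomology.map ((W.torsionInclusion (Dvd.intro m hdm)).restrictField E) 1 z ∈
      W.kummerLocalConditionAt N E) :
    ∃ (R : localPoints W E)
      (hR : N • R ∈ MulAction.fixedPoints (absoluteGaloisGroup E) (localPoints W E)),
      galoisCohomology.map ((W.torsionInclusion (Dvd.intro m hdm)).restrictField E) 1 z =
        m • W.localKummerClass N hN R hR := by
  have hm : (m : ℤ) ≠ 0 := by
    rintro hm0
    rw [hm0, mul_zero] at hdm
    exact hN hdm.symm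
  -- `z` is a level-`d` local Kummer class
  have hzd : z ∈ W.kummerLocalConditionAt d E :=
    mem_kummerLocalConditionAt_of_map_torsionInclusion_mem W E (Dvd.intro (m : ℤ) hdm) hz
  obtain ⟨Q, hQ, rfl⟩ := W.exists_eq_localKummerClass_of_mem d hd hzd
  -- divide `Q` by `m`
  obtain ⟨R, hRQ⟩ : ∃ R : localPoints W E, (m : ℤ) • R = Q :=
    (W.baseChange (AlgebraicClosure E)).zsmul_surjective_of_isAlgClosed hm Q
  rw [natCast_zsmul] at hRQ
  have hNR : N • R = d • Q := by rw [← hdm, mul_zsmul, natCast_zsmul, hRQ]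
  have hR : N • R ∈ MulAction.fixedPoints (absoluteGaloisGroup E) (localPoints W E) := by
    rw [hNR]; exact hQ
  have hNQ : N • (m • R) ∈ MulAction.fixedPoints (absoluteGaloisGroup E) (localPoints W E) := by
    rw [← natCast_zsmul]; exact zsmul_zsmul_mem_fixedPoints_localPoints W N (m : ℤ) hR
  refine ⟨R, hR, ?_⟩
  rw [W.map_torsionInclusion_localKummerClass (Dvd.intro (m : ℤ) hdm) hd hN Q hQ (hRQ ▸ hNQ),
    ← localKummerClass_nsmul W N hN m R hR hNQ]
  exact localKummerClass_congr hRQ.symm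

end KummerMultiples

/-! ## §3 The local term of Cassels' obstruction vanishes (every place, every family `inv`) -/

section LocalTerm

variable {K : Type u} [Field K] [NumberField K] (W : WeierstrassCurve K) [W.IsElliptic]
variable (n : ℕ) [NeZero n]
variable (e : geomTorsion W n → geomTorsion W n → AlgebraicClosure K)
  (hμ : ∀ S T, e S T ^ n = 1)
  (hadd₁ : ∀ S₁ S₂ T, e (S₁ + S₂) T = e S₁ T * e S₂ T)
  (hadd₂ : ∀ S T₁ T₂, e S (T₁ + T₂) = e S T₁ * e S T₂)
  (hgal : ∀ (σ : absoluteGaloisGroup K) (S T : geomTorsion W n), σ • e S T = e (σ • S) (σ • T))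
  (halt : ∀ T, e T T = 1)
  (inv : LocalInvariants K n)

include halt in
/-- **`inv_v(t ∪ₑ (m • l)) = 0` when `m • t ∈ 𝓛_v` and `l ∈ 𝓛_v`**: bilinearity moves `m` onto `t`, and the
local Kummer condition is isotropic for `inv_v(· ∪ₑ ·)` at EVERY place for EVERY family `inv` (tree
`invWeilPairing_eq_zero_of_mem`, the discharged Poonen–Rains isotropy). [cite: PoonenRains2012, Prop. 4.10]
[cite: MilneADT2006, Ch. I, Lemma 6.15] -/
theorem invWeilPairing_nsmul_eq_zero_of_nsmul_mem (v : Place K) (m : ℕ)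
    {t l : galoisCohomology ((W.torsionGaloisModule n).toLocal v) 1}
    (ht : m • t ∈ W.kummerSelmerStructure n v) (hl : l ∈ W.kummerSelmerStructure n v) :
    Summit.BirchSwinnertonDyer.Rank1Residual.X11b.Relaxation.invWeilPairing W n e hμ hadd₁ hadd₂ hgal inv v
      t (m • l) = 0 := by
  have h := Summit.BirchSwinnertonDyer.Rank1Residual.X11b.Relaxation.invWeilPairing_eq_zero_of_mem W n e hμ
    hadd₁ hadd₂ hgal halt inv v ht hl
  rw [map_nsmul, AddMonoidHom.nsmul_apply] at h
  rw [map_nsmul]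
  exact h

end LocalTerm

end Summit.BirchSwinnertonDyer.BirchSwinnertonDyer.Theorems.SignedEC.CasselsPT

end
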